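import Mathlib
import HarnessLib
import Summits.HubbardSuperconductivity.HubbardSuperconductivity.Theorems.KLProgrammeKLRegimeCountertermReading
import Summits.HubbardSuperconductivity.HubbardSuperconductivity.Theorems.KLProgrammeKLRegimeCountertermFrameCurveLipschitz

/-!
# Route `KLProgramme` — the Counterterm child of crux K3 (gen-2 item stmt-HubbardSuperconductivity-19664, gen-3 twin
# `CountertermP2 klPredsV11 klWindowC`): THE READING INEQUALITY KEYED BY THE FRAME — the geometric side conditions of
# `…CountertermReading` discharged under p4's frame hypotheses, and the angular Lipschitz constant of the frame on its own curve
# (seat hubbard-kl-k3c3-p1, part D of `…CountertermMuFlow/MuFlowExt/Reading`)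

`…CountertermReading` (part C) proves, for ANY frame `F`, `|ν_n(F)(θ) − (F(q_θ) + Σ_{i ≤ n} ℓ_i^G(F)(q_θ))| ≤ Λ_ℓ·2π/L +
Λ_w·π·(2π/L)/r` at the frame's Fermi point `q_θ`, under side conditions on `q_θ` (on the curve `{ε₀ = μ + F}`, seam margin, small
`|F(q_θ)|`, radius `≥ r`) and with the angular Lipschitz constant `Λ_w` of the two-leg output proper `w_n(F) = ν_n(F) − F∘k_F(F)`.
Here all of these are DISCHARGED from p4 g5's frame hypotheses (`…H10TwoPointLimitFrameFermiPoint`): a level range `[a, b]`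
with `B : BandBounds a b`, a frame `K` of `C²` size `A` (`‖Dʲ(frameShift K)‖ ≤ A`, `j ≤ 2`) with `2A < Dt_min` and
`[μ − A, μ + A] ⊂ [a, b]`:

* §1 the side conditions: the Fermi point lies on the curve in the `eps2` spelling (`eps2_klFermiPoint_eq`), inside the open square
  (`abs_klFermiPoint_lt_pi`) with seam margin `2π/L` for `L ≥ 20`, `μ ≤ −0.15`, `A ≤ 1/20` (`seamMargin_klFermiPoint`), the frame is
  small there (`abs_eval_klFermiPoint_le`), the radius is in `[umin, 2π)` (k3c3-p3's `umin_le_frameRadius`), and both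
  profiles are continuous, hence interval-integrable (`intervalIntegrable_klLocalPart`, `intervalIntegrable_frameOnCurve`);
* §2 the two-leg output proper `w_n(K) = ν_n(K) − K∘k_F(K)` is `(Λ_ν + Λ_K)`-Lipschitz whenever `ν_n(K)` is `Λ_ν`-Lipschitz ((E3g₁)),
  with `Λ_K = 2A·π√2·(1 + (4 + 2A)/(Dt_min − 2A))` the frame-on-curve constant of k3c3-p3's `abs_frameOnCurve_sub_le`
  (`…CountertermFrameCurveLipschitz`) (`abs_twoLegOutput_sub_le`);
* §3 **THE GATE LEMMA `renormalisedAtF_of_partialSum_frame`**: a UNIFORM sup bound `B₀` of the polynomial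
  `K ⊕ Σ_{i ≤ n} ℓ_i^G(K)`, a sup-metric Lipschitz constant `Λ_ℓ` of `Σ_{i ≤ n} ℓ_i^G(K)` ((E3a) `j = 1`), an angular Lipschitz
  constant `Λ_ν` of `ν_n(K)` ((E3g₁)), `L ≥ max(20, 8π/klFlatR)` with `2π/L < umin`, and the tolerance arithmetic
  `B₀ + Λ_ℓ·2π/L + (Λ_ν + Λ_K)·π·(2π/L)/umin ≤ cr·|U|·Λ_n²/e₀` give `RenormalisedAtF L M β U μ K R n` — the renormalisation of every
  Picard iterate of the wholesale continuation (k3c3-p2) and of the final frame, read off ONE sup norm (`abs_klLocalPart_le_of_partialSum_frame`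
  is the pointwise form).

Proofs only; nothing is asserted about the Hubbard model.  References: BGM 2006 §2.4 Lemma 2.1 (2.40); HOME/prover-p4/INVERSION-NOTE.md.
-/

noncomputable section

namespace Summit.HubbardSuperconductivity.HubbardSuperconductivity.Theorems.KLRegimeSplit

set_option linter.dupNamespace false -- summit = problem name (single-conjunct summit), D-0017

open Real Finset MeasureTheory Set
open Literature.MathematicalPhysics.QuantumLattice Literature.Probability.LatticeModels
open Literature.MathematicalPhysics.QuantumLattice.BandSectorCounting
open Summit.HubbardSuperconductivity.HubbardSuperconductivity.Theorems.KLProgrammeLegKernels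
open Summit.HubbardSuperconductivity.HubbardSuperconductivity.Theorems.PerturbedFermiCurve
open Summit.HubbardSuperconductivity.HubbardSuperconductivity.Theorems.DispersionFlow

section Frame

variable {a b : ℝ} (B : BandBounds a b) {K : TrigPolyC4v} {A : ℝ}
  (hA : ∀ p : Momentum, ∀ j ≤ 2, ‖iteratedFDeriv ℝ j (frameShift K) p‖ ≤ A) (hADt : 2 * A < B.Dtmin)
  {μ : ℝ} (hlo : a ≤ μ - A) (hhi : μ + A ≤ b)
include B hA hlo hhi

/-! ## §1 The side conditions of the reading inequality, from the frame hypotheses -/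

omit B hA hlo hhi in
/-- `δ_K = −K` is continuous (for p4's `Spec` lemmas). -/
theorem continuous_neg_eval_frame : Continuous (fun p : Fin 2 → ℝ => -K.eval p) := by
  have h := continuous_frameShift_toLp K
  simpa [frameShift_toLp] using h

/-- **The Fermi point lies on the frame's curve, `eps2` spelling**: `ε₀(q_θ) = μ + K(q_θ)`. -/
theorem eps2_klFermiPoint_eq (θ : ℝ) :
    eps2 (klFermiPoint μ K θ 0) (klFermiPoint μ K θ 1) = μ + K.eval (klFermiPoint μ K θ) := by
  have h := sqDispersion_add_perturbedFermiRadius B (continuous_neg_eval_frame (K := K))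
    (abs_neg_eval_le_of_frameSize hA) hlo hhi θ
  rw [sqDispersion_eq_eps2] at h
  show eps2 ((perturbedFermiRadius (fun p => -K.eval p) μ θ • dir θ) 0)
      ((perturbedFermiRadius (fun p => -K.eval p) μ θ • dir θ) 1) =
    μ + K.eval (perturbedFermiRadius (fun p => -K.eval p) μ θ • dir θ)
  linarith

/-- The Fermi point lies in the open square: `|q_θ,i| < π`. -/
theorem abs_klFermiPoint_lt_pi (θ : ℝ) (i : Fin 2) : |klFermiPoint μ K θ i| < π :=
  abs_perturbedFermiRadius_smul_dir_lt B (continuous_neg_eval_frame (K := K)) (abs_neg_eval_le_of_frameSize hA) hlo hhi θ i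

omit B hlo hhi in
/-- The frame is small at its Fermi point: `|K(q_θ)| ≤ A`. -/
theorem abs_eval_klFermiPoint_le (θ : ℝ) : |K.eval (klFermiPoint μ K θ)| ≤ A := by
  have h := abs_frameShift_toLp_le hA (klFermiPoint μ K θ)
  rwa [frameShift_toLp, abs_neg] at h

/-- **Seam margin**: for `L ≥ 20`, `μ ≤ −0.15` and `A ≤ 1/20` the Fermi point is `2π/L` inside the square. -/
theorem seamMargin_klFermiPoint {L : ℕ} [NeZero L] (hL : (20 : ℝ) ≤ L) (hμ : μ ≤ -0.15) (hA20 : A ≤ 1 / 20) (θ : ℝ) :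
    ∀ i, |klFermiPoint μ K θ i| ≤ π - 2 * π / L :=
  seamMargin_of_levelPoint L (fun i => (abs_klFermiPoint_lt_pi B hA hlo hhi θ i).le) (eps2_klFermiPoint_eq B hA hlo hhi θ) hμ
    ((abs_eval_klFermiPoint_le hA θ).trans hA20) hL

include hADt in
/-- The local-part profile is interval-integrable on `[0, 2π]` (it is `C^∞`, p4). -/
theorem intervalIntegrable_klLocalPart (L M : ℕ) [NeZero L] [NeZero M] (β U : ℝ) (n : ℕ) :
    IntervalIntegrable (klLocalPart L M β U μ K n) volume 0 (2 * π) :=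
  ((contDiff_klLocalPart B hA hADt hlo hhi L M β U n (m := 0)).continuous).intervalIntegrable _ _

include hADt in
/-- The frame read on its curve is interval-integrable on `[0, 2π]`. -/
theorem intervalIntegrable_frameOnCurve (K' : TrigPolyC4v) :
    IntervalIntegrable (fun θ => K'.eval (klFermiPoint μ K θ)) volume 0 (2 * π) :=
  ((contDiff_eval_klFermiPoint B hA hADt hlo hhi K' (m := 0)).continuous).intervalIntegrable _ _

/-! ## §2 The two-leg output proper is Lipschitz in the angle -/

include hADt in
/-- **The two-leg output proper is Lipschitz in the angle**: if `ν_n(K)` is `Λ_ν`-Lipschitz ((E3g₁)) then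
`w_n(K) = ν_n(K) − K∘k_F(K)` is `(Λ_ν + 2A·π√2·(1 + (4+2A)/(Dt_min − 2A)))`-Lipschitz. -/
theorem abs_twoLegOutput_sub_le (L M : ℕ) [NeZero L] [NeZero M] (β U : ℝ) (n : ℕ) {Λν : ℝ}
    (hLipν : ∀ a' b', |klLocalPart L M β U μ K n a' - klLocalPart L M β U μ K n b'| ≤ Λν * |a' - b'|) (a' b' : ℝ) :
    |(klLocalPart L M β U μ K n a' - K.eval (klFermiPoint μ K a')) -
        (klLocalPart L M β U μ K n b' - K.eval (klFermiPoint μ K b'))| ≤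
      (Λν + 2 * A * (π * Real.sqrt 2 * (1 + (4 + 2 * A) / (B.Dtmin - 2 * A)))) * |a' - b'| := by
  have h1 := hLipν a' b'
  have h2 := abs_frameOnCurve_sub_le B hA hlo hhi hADt a' b'
  have e : (klLocalPart L M β U μ K n a' - K.eval (klFermiPoint μ K a')) -
      (klLocalPart L M β U μ K n b' - K.eval (klFermiPoint μ K b')) =
      (klLocalPart L M β U μ K n a' - klLocalPart L M β U μ K n b') -
        (K.eval (klFermiPoint μ K a') - K.eval (klFermiPoint μ K b')) := by ring
  rw [e, add_mul]
  exact (abs_sub _ _).trans (add_le_add h1 h2)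

/-! ## §3 The gate lemma: `RenormalisedAtF` of a frame from the sup norm of its partial sum -/

include hADt in
/-- **THE READING INEQUALITY KEYED BY THE FRAME** (pointwise form).  With `Λ_K := 2A·π√2·(1 + (4+2A)/(Dt_min − 2A))`:
`|ν_n(K)(θ)| ≤ B₀ + Λ_ℓ·2π/L + (Λ_ν + Λ_K)·π·(2π/L)/umin` whenever `|K(q_θ) + Σ_{i ≤ n} ℓ_i^G(K)(q_θ)| ≤ B₀`. -/
theorem abs_klLocalPart_le_of_partialSum_frame (L M : ℕ) [NeZero L] [NeZero M] (β U : ℝ) (n : ℕ)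
    (hμ : μ ≤ -0.15) (hA20 : A ≤ 1 / 40) (hL20 : (20 : ℝ) ≤ L) (hLflat : 8 * π / klFlatR ≤ L) (hLu : 2 * π / L < B.umin)
    {Λν : ℝ} (hΛν : 0 ≤ Λν)
    (hLipν : ∀ a' b', |klLocalPart L M β U μ K n a' - klLocalPart L M β U μ K n b'| ≤ Λν * |a' - b'|)
    {Λℓ : ℝ} (hΛℓ : 0 ≤ Λℓ)
    (hLipℓ : ∀ p p' : Fin 2 → ℝ, |∑ i ∈ range (n + 1), (klTwoLegPieceG L M β U μ K i).eval p -
        ∑ i ∈ range (n + 1), (klTwoLegPieceG L M β U μ K i).eval p'| ≤ Λℓ * (|p 0 - p' 0| + |p 1 - p' 1|))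
    (θ : ℝ) {B₀ : ℝ} (hB : |K.eval (klFermiPoint μ K θ) +
        ∑ i ∈ range (n + 1), (klTwoLegPieceG L M β U μ K i).eval (klFermiPoint μ K θ)| ≤ B₀) :
    |klLocalPart L M β U μ K n θ| ≤ B₀ + (Λℓ * (2 * π / L) +
      (Λν + 2 * A * (π * Real.sqrt 2 * (1 + (4 + 2 * A) / (B.Dtmin - 2 * A)))) * π * (2 * (π / L) / B.umin)) := by
  have hA0 : 0 ≤ A := by
    have := hA 0 0 (by norm_num)
    exact (norm_nonneg _).trans this
  have hDt : 0 < B.Dtmin - 2 * A := by linarith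
  have hμ' : μ ≤ -(1 / 10) := by linarith
  have hΛw : 0 ≤ Λν + 2 * A * (π * Real.sqrt 2 * (1 + (4 + 2 * A) / (B.Dtmin - 2 * A))) := by positivity
  exact abs_klLocalPart_le_of_partialSum L M hμ' β U K n (intervalIntegrable_klLocalPart B hA hADt hlo hhi L M β U n)
    (intervalIntegrable_frameOnCurve B hA hADt hlo hhi K) hΛw (abs_twoLegOutput_sub_le B hA hADt hlo hhi L M β U n hLipν)
    hΛℓ hLipℓ (seamMargin_klFermiPoint B hA hlo hhi hL20 hμ (by linarith) θ) (eps2_klFermiPoint_eq B hA hlo hhi θ)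
    ((abs_eval_klFermiPoint_le hA θ).trans (by rw [klFlatR]; linarith)) hLflat hLu (umin_le_frameRadius B hA hlo hhi θ) hB

include hADt in
/-- **THE GATE LEMMA.**  For a frame `K` under p4's hypotheses (`B : BandBounds a b`, `C²`-size `A ≤ 1/40` with `2A < Dt_min`,
`[μ − A, μ + A] ⊂ [a, b]`, `μ ≤ −0.15`), a volume `L ≥ max(20, 8π/klFlatR)` with `2π/L < umin`, an angular Lipschitz constant `Λ_ν` of
`ν_n(K)` ((E3g₁)), a sup-metric Lipschitz constant `Λ_ℓ` of the polynomial `Σ_{i ≤ n} ℓ_i^G(K)` ((E3a) `j = 1`) and a UNIFORM sup bound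
`B₀` of `K ⊕ Σ_{i ≤ n} ℓ_i^G(K)`: if `B₀ + Λ_ℓ·2π/L + (Λ_ν + Λ_K)·π·(2π/L)/umin ≤ cr·|U|·Λ_n²/e₀` then `RenormalisedAtF L M β U μ K R n`. -/
theorem renormalisedAtF_of_partialSum_frame (L M : ℕ) [NeZero L] [NeZero M] (β U : ℝ) (R : RenConsts) (n : ℕ)
    (hμ : μ ≤ -0.15) (hA20 : A ≤ 1 / 40) (hL20 : (20 : ℝ) ≤ L) (hLflat : 8 * π / klFlatR ≤ L) (hLu : 2 * π / L < B.umin)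
    {Λν : ℝ} (hΛν : 0 ≤ Λν)
    (hLipν : ∀ a' b', |klLocalPart L M β U μ K n a' - klLocalPart L M β U μ K n b'| ≤ Λν * |a' - b'|)
    {Λℓ : ℝ} (hΛℓ : 0 ≤ Λℓ)
    (hLipℓ : ∀ p p' : Fin 2 → ℝ, |∑ i ∈ range (n + 1), (klTwoLegPieceG L M β U μ K i).eval p -
        ∑ i ∈ range (n + 1), (klTwoLegPieceG L M β U μ K i).eval p'| ≤ Λℓ * (|p 0 - p' 0| + |p 1 - p' 1|))
    {B₀ : ℝ} (hB : ∀ q : Fin 2 → ℝ, |K.eval q + ∑ i ∈ range (n + 1), (klTwoLegPieceG L M β U μ K i).eval q| ≤ B₀)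
    (htol : B₀ + (Λℓ * (2 * π / L) +
      (Λν + 2 * A * (π * Real.sqrt 2 * (1 + (4 + 2 * A) / (B.Dtmin - 2 * A)))) * π * (2 * (π / L) / B.umin)) ≤
        R.cr * |U| * klScale klE0 n ^ 2 / klE0) :
    RenormalisedAtF L M β U μ K R n := fun θ =>
  (abs_klLocalPart_le_of_partialSum_frame B hA hADt hlo hhi L M β U n hμ hA20 hL20 hLflat hLu hΛν hLipν hΛℓ hLipℓ θ
    (hB _)).trans htol

end Frame

end Summit.HubbardSuperconductivity.HubbardSuperconductivity.Theorems.KLRegimeSplit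

end
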